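/-
Copyright (c) 2026 the pub-hodgecm-mathlib formalisation cell (harness21).  Prover seat hodgecm-mathlib-F0P3a-p04 (g12), (F12) HEAD 3 «STUB-FRAME ADAPTER, TYPE (1)»
(architect A-p06 (g26) «=» 2026-09-01 04:24:53Z ∕ 05:20:11Z; LEAD F0P3a-plan (g9) T8-51 (C); line «N7nsCount» ED. 1.4 `stub_splitGValueSum`).
-/
import Literature.NumberTheory.Rogawski1990.UnitFundamentalLemmaInertSplitClauseOfValues        -- ★ p841086 (this seat): HEADS 1–2, values-abstract assembly
import Literature.NumberTheory.Rogawski1990.UnitFundamentalLemmaInertFlickerRepresentatives     -- ★ p841570 (F0P3-p02): the four matched representatives (FILE A)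
import Literature.NumberTheory.Rogawski1990.UnitFundamentalLemmaInertFlickerKappaSigns           -- ★ (this seat, FILE B): their signs `(+1,+1,−1,−1)`
import Literature.NumberTheory.Rogawski1990.FinExplicitTransferFactorInertExponent               -- ★ p840918 (A-p13): `log |χ_g(u)|_w = −(N₁+N₂)`, `χ_g(u)` a unit
import Literature.NumberTheory.Automorphic.LocalRegularOrbitClosed                               -- ★ `map_conjLocal_transpose_localForm`, `isUnit_det_localForm`
import HarnessLib

/-!
# The type-(1) `G′`-side sum FROM THE FOUR VALUES in the stub frame of `stub_splitGValueSum` — the adapter (F12) HEAD 3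
# (Flicker 1998 Prop. 3 p. 78, §6 p. 95; Rogawski 1990 Prop. 4.9.1 (b), (4.3.1)–(4.3.2))

Topic `NumberTheory/Rogawski1990`; namespace `Literature.NumberTheory.Rogawski1990`.  THEOREMS ONLY (no definition, no instance, no notation, no named fact, no `sorry`);
kernel lane.  Cell `pub/hodgecm-mathlib`, crux H413 = `stmt-HodgeConjecture-24833`, road «D-N7-inert», MAP v3 (F12), the type-(1) twin of ★ B-p14's
`UnitFundamentalLemmaInertIrredClauseOfValuesStubFrame`.  HONEST LABEL: HC_CM is proved only modulo the printed citations until rung 0 closes; this file proves the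
ASSEMBLY of the `G′`-side of the split clause from four orbital-integral VALUES, not the values (Flicker's Props. 11–14, LAYER B∕C).

THE STATEMENT (**`finsum_finExplicitDelta_mul_classOrbitalIntegral_eq_of_split_of_values`**).  In the frame of the line's `stub_splitGValueSum` (non-split unramified
`w ∣ v` of good reduction for the hermitian `H′`, `μ` unramified at `w` under the N7 μ-guard, `γ_H = (g, u)` with the split eigen-data of ★ `stub_splitExponents`:
roots `α ≠ γ` of `χ_{g,w}` with `ord_w(α − u_w) = N₁`, `ord_w(γ − u_w) = N₂`), given ONCE the auxiliary data every value theorem also consumes — Flicker's scalars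
`e = ½`, `π` (a `σ`-fixed non-norm), `x x̄ = 2`, `y ȳ = −2` (★ `exists_flicker_scalars_of_nonsplit`) and an eigenframe `g P₂ = P₂ diag(a, d)` of `g` over `E_v` with
norm-one `a ≠ d` off `u` (★ (E1) `exists_eigenframe_cmDatum_local_of_isRoot_map_of_separable`, `a_w = α`) — and FOUR VALUES `X₁ … X₄ ∈ ℂ` attached to Flicker's
literals `t_1(a,u,d)`, `t_π(a,u,d)`, `t_π(a,d,u)`, `t_π(u,a,d)` through ANY congruence `Tl` with `ᵗσ(Tl) Φ₃ Tl = H′_v` («`Φ(⟦t⟧, f) = Xᵢ` whenever `Tl t Tl⁻¹` IS the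
`i`-th literal» — intrinsic labels, no norm tests, no `Quotient.out`), one has
`∑ᶠ c, Δ‴_v(γ_H, out c) · Φ(c, f) = (−q_v)^{−(N₁+N₂)} · (X₁ + X₂ − X₃ − X₄)` for every test function `f` and orbital-measure family `mG`.
PROOF = ★ F0P3-p02 `exists_four_matched_flicker_representatives` (the four matched `tᵢ`, the frame of `t₁`, `t₁ ≁ t₂`, `t₃ ≁ t₄`, the literal images) ∘ ★ FILE B
`finKappaAt_flicker_representatives_eq` (`κ = (+,+,−,−)`) ∘ ★ HEAD 1 `finsum_delta_mul_classOrbitalIntegral_eq_of_four_classes_of_values` ∘ ★ A-p13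
`log_valued_eval_finCharpolyTwo_apply_eq_neg_add` (the exponent).  With `f = 1_{K′}` and the values `phiZero q N₁ N₂ N`, `phiOne q N₁ N`, `phiOne q N N₁`, `phiOne q N₁ N₂`
(A-p03's certified slot assignment) the right-hand side is `(−q)^{−(N₁+N₂)} · phiKappa q N₁ N₂ N` = the line's `stub_splitGValueSum` (★ def `phiKappa`).

## References
* [Flicker1998UnitaryFL] Y. Z. Flicker, *Elementary proof of the fundamental lemma for a unitary group*, Canad. J. Math. 50 (1998), Prop. 3 p. 78, §3 p. 80, §6 p. 95.
* [Rogawski1990] J. D. Rogawski, *Automorphic Representations of Unitary Groups in Three Variables* (1990), §4.3 (4.3.1)–(4.3.2) p. 43, §4.9 Prop. 4.9.1 (b) p. 55.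
-/

set_option autoImplicit false

noncomputable section

open NumberField IsDedekindDomain Matrix Polynomial
open scoped MatrixGroups

namespace Literature.NumberTheory.Rogawski1990

open Literature.NumberTheory.Automorphic Literature.NumberTheory.Automorphic.UnitaryGroup
open Literature.NumberTheory.GaloisRepresentations Literature.NumberTheory.NumberFields Literature.NumberTheory.QuadraticForms

section Adapter

variable (L : Type) [Field L] [NumberField L] [IsCMField L] {v : HeightOneSpectrum (𝓞 ↥(maximalRealSubfield L))} (H' : Matrix (Fin 3) (Fin 3) L)

set_option maxHeartbeats 400000 in
open scoped Classical in
/-- **(F12) HEAD 3 — THE TYPE-(1) `G′`-SIDE SUM FROM THE FOUR VALUES, in the stub frame.**  See the module docstring: `Xᵢ` is the orbital integral of `f` on the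
class of ANY `t ∈ G′_v` whose image `Tl t Tl⁻¹` under a congruence `Tl` (`ᵗσ(Tl) Φ₃ Tl = H′_v`) is Flicker's `i`-th literal at `(e; a, u, d; π)`; then
`∑ᶠ c, Δ‴_v(γ_H, out c)·Φ(c, f) = (−q_v)^{−(N₁+N₂)}·(X₁ + X₂ − X₃ − X₄)`. [cite: Flicker1998UnitaryFL, Prop. 3 p. 78; §6 p. 95]
[cite: Rogawski1990, §4.3 (4.3.1)–(4.3.2) p. 43; §4.9 Prop. 4.9.1 (b) p. 55] -/
theorem finsum_finExplicitDelta_mul_classOrbitalIntegral_eq_of_split_of_values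
    (hH' : (H'.map (IsCMField.complexConj L))ᵀ = H') (w : PlacesOver L v)
    (hw : IsCMField.complexConj L • w.1 = w.1) (hv : Algebra.IsUnramifiedIn (𝓞 L) v.asIdeal)
    (hH'w : IsUnit (placeForm H' w.1)) (hH'i : hH'w.unit ∈ glInt 3 (w.1.adicCompletion L))
    (μ : HeckeCharacter L) (hμ : μ.IsUnramifiedAt w.1)
    [∀ γ : ((cmDatum L 3 H').Local v), MeasurableSpace (((cmDatum L 3 H').Local v) ⧸ Subgroup.centralizer ({γ} : Set ((cmDatum L 3 H').Local v)))]
    (hl : ∀ (v : HeightOneSpectrum (𝓞 ↥(maximalRealSubfield L)))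
      (a : (cmDatum L 2 (Matrix.of fun i j : Fin 2 => if i.val + j.val + 1 = 2 then (1 : L) else 0)).Local v ×
      (cmDatum L 1 (Matrix.of fun i j : Fin 1 => if i.val + j.val + 1 = 1 then (1 : L) else 0)).Local v)
      (b : (cmDatum L 3 H').Local v)
      (x : (cmDatum L 2 (Matrix.of fun i j : Fin 2 => if i.val + j.val + 1 = 2 then (1 : L) else 0)).Local v ×
      (cmDatum L 1 (Matrix.of fun i j : Fin 1 => if i.val + j.val + 1 = 1 then (1 : L) else 0)).Local v),
      finExplicitDelta L v H' (x * a * x⁻¹) μ b = finExplicitDelta L v H' a μ b)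
    (hr : ∀ (v : HeightOneSpectrum (𝓞 ↥(maximalRealSubfield L)))
      (a : (cmDatum L 2 (Matrix.of fun i j : Fin 2 => if i.val + j.val + 1 = 2 then (1 : L) else 0)).Local v ×
      (cmDatum L 1 (Matrix.of fun i j : Fin 1 => if i.val + j.val + 1 = 1 then (1 : L) else 0)).Local v)
      (b y : (cmDatum L 3 H').Local v),
      finExplicitDelta L v H' a μ (y * b * y⁻¹) = finExplicitDelta L v H' a μ b)
    (hH'u : IsUnit H')
    (hμω : ∀ x : ideleGroup ↥(maximalRealSubfield L), μ (AdeleRing.ideleBaseChange ↥(maximalRealSubfield L) L x) = quadraticHeckeCharCM L x)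
    {γH : ((cmDatum L 2 (Matrix.of fun i j : Fin 2 => if i.val + j.val + 1 = 2 then (1 : L) else 0)).Local v ×
      (cmDatum L 1 (Matrix.of fun i j : Fin 1 => if i.val + j.val + 1 = 1 then (1 : L) else 0)).Local v)}
    -- the split eigen-data of `stub_splitExponents`
    (α γ : w.1.adicCompletion L) (N₁ N₂ : ℕ)
    (hα : ((((γH.1.val : GL (Fin 2) (LocalRing L v)) : Matrix (Fin 2) (Fin 2) (LocalRing L v)).charpoly).map
        (Pi.evalRingHom (fun w' : PlacesOver L v => w'.1.adicCompletion L) w)).IsRoot α)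
    (hγ : ((((γH.1.val : GL (Fin 2) (LocalRing L v)) : Matrix (Fin 2) (Fin 2) (LocalRing L v)).charpoly).map
        (Pi.evalRingHom (fun w' : PlacesOver L v => w'.1.adicCompletion L) w)).IsRoot γ)
    (hαγ : α ≠ γ)
    (hN₁ : Valued.v (α - finGammaTwo L v γH w) = WithZero.exp (-(N₁ : ℤ)))
    (hN₂ : Valued.v (γ - finGammaTwo L v γH w) = WithZero.exp (-(N₂ : ℤ)))
    -- Flicker's scalars (★ `exists_flicker_scalars_of_nonsplit`) and an eigenframe of `g` over `E_v` (★ (E1))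
    {e π π' x y a d : LocalRing L v} (h2e : 2 * e = 1) (hσπ : conjLocal L (IsCMField.complexConj L) v π = π) (hππ : π * π' = 1)
    (hπN : ∀ z : LocalRing L v, conjLocal L (IsCMField.complexConj L) v z * z ≠ π)
    (hx : conjLocal L (IsCMField.complexConj L) v x * x = 2) (hy : conjLocal L (IsCMField.complexConj L) v y * y = -2)
    (ha1 : conjLocal L (IsCMField.complexConj L) v a * a = 1) (hd1 : conjLocal L (IsCMField.complexConj L) v d * d = 1)
    {P₂ : GL (Fin 2) (LocalRing L v)} (hP₂ : (γH.1.val.val : Matrix (Fin 2) (Fin 2) (LocalRing L v)) * P₂.val = P₂.val * diagonal ![a, d])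
    (had : a ≠ d) (hab : a ≠ finGammaTwo L v γH) (hbd : finGammaTwo L v γH ≠ d)
    -- the test function, the family, and the four VALUES labelled by Flicker's literals
    (mG : OrbitalMeasureFamily ((cmDatum L 3 H').Local v)) (f : (cmDatum L 3 H').Local v → ℂ) {X₁ X₂ X₃ X₄ : ℂ}
    (hΦ₁ : ∀ (Tl : GL (Fin 3) (LocalRing L v)) (t : (cmDatum L 3 H').Local v),
      formCongr (conjLocal L (IsCMField.complexConj L) v) Tl (Matrix.of fun i j : Fin 3 => if i.val + j.val + 1 = 3 then (1 : LocalRing L v) else 0) =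
          (adelicForm L 3 H').map (adeleToLocal L v) →
      (Tl * t.val * Tl⁻¹).val =
          !![e * (a + d), 0, -(e * (a - d)); 0, finGammaTwo L v γH, 0; -(e * (a - d)), 0, e * (a + d)] →
      classOrbitalIntegral mG f (ConjClasses.mk t) = X₁)
    (hΦ₂ : ∀ (Tl : GL (Fin 3) (LocalRing L v)) (t : (cmDatum L 3 H').Local v),
      formCongr (conjLocal L (IsCMField.complexConj L) v) Tl (Matrix.of fun i j : Fin 3 => if i.val + j.val + 1 = 3 then (1 : LocalRing L v) else 0) =
          (adelicForm L 3 H').map (adeleToLocal L v) →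
      (Tl * t.val * Tl⁻¹).val =
          !![e * (a + d), 0, -(e * (a - d) * π); 0, finGammaTwo L v γH, 0; -(e * (a - d) * π'), 0, e * (a + d)] →
      classOrbitalIntegral mG f (ConjClasses.mk t) = X₂)
    (hΦ₃ : ∀ (Tl : GL (Fin 3) (LocalRing L v)) (t : (cmDatum L 3 H').Local v),
      formCongr (conjLocal L (IsCMField.complexConj L) v) Tl (Matrix.of fun i j : Fin 3 => if i.val + j.val + 1 = 3 then (1 : LocalRing L v) else 0) =
          (adelicForm L 3 H').map (adeleToLocal L v) →
      (Tl * t.val * Tl⁻¹).val =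
          !![e * (a + finGammaTwo L v γH), 0, -(e * (a - finGammaTwo L v γH) * π); 0, d, 0;
             -(e * (a - finGammaTwo L v γH) * π'), 0, e * (a + finGammaTwo L v γH)] →
      classOrbitalIntegral mG f (ConjClasses.mk t) = X₃)
    (hΦ₄ : ∀ (Tl : GL (Fin 3) (LocalRing L v)) (t : (cmDatum L 3 H').Local v),
      formCongr (conjLocal L (IsCMField.complexConj L) v) Tl (Matrix.of fun i j : Fin 3 => if i.val + j.val + 1 = 3 then (1 : LocalRing L v) else 0) =
          (adelicForm L 3 H').map (adeleToLocal L v) →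
      (Tl * t.val * Tl⁻¹).val =
          !![e * (finGammaTwo L v γH + d), 0, -(e * (finGammaTwo L v γH - d) * π); 0, a, 0;
             -(e * (finGammaTwo L v γH - d) * π'), 0, e * (finGammaTwo L v γH + d)] →
      classOrbitalIntegral mG f (ConjClasses.mk t) = X₄) :
    ∑ᶠ c : ConjClasses ((cmDatum L 3 H').Local v),
        (finExplicitCollection L H' μ hl hr v).Δ γH (Quotient.out c) * classOrbitalIntegral mG f c =
      (-(Ideal.absNorm v.asIdeal : ℂ)) ^ (-((N₁ : ℤ) + N₂)) * (X₁ + X₂ - X₃ - X₄) := by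
  have hvs : Subsingleton (PlacesOver L v) :=
    PlacesOver.subsingleton_of_smul_eq (IsCMField.complexConj L) (IsCMField.complexConj_ne_one L) w hw
  -- (1) `χ_g(u)` is a unit and the exponent is `−(N₁+N₂)` (★ A-p13)
  have hα' : ((finCharpolyTwo L v γH).map (Pi.evalRingHom (fun w' : PlacesOver L v => w'.1.adicCompletion L) w)).IsRoot α := hα
  have hγ' : ((finCharpolyTwo L v γH).map (Pi.evalRingHom (fun w' : PlacesOver L v => w'.1.adicCompletion L) w)).IsRoot γ := hγ
  have hαb : α ≠ finGammaTwo L v γH w := fun h0 => by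
    rw [h0, sub_self, map_zero] at hN₁; exact WithZero.zero_ne_coe hN₁
  have hγb : γ ≠ finGammaTwo L v γH w := fun h0 => by
    rw [h0, sub_self, map_zero] at hN₂; exact WithZero.zero_ne_coe hN₂
  have hu : IsUnit ((finCharpolyTwo L v γH).eval (finGammaTwo L v γH)) := isUnit_eval_finCharpolyTwo_of_isRoot L v w γH hvs hα' hγ' hαγ hαb hγb
  have hlog := log_valued_eval_finCharpolyTwo_apply_eq_neg_add L v w γH hα' hγ' hαγ hN₁ hN₂
  -- (2) the local hermitian data of `H′`
  have hH'c : (H'.map (cmConjRingHom L))ᵀ = H' := by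
    have e1 : H'.map (cmConjRingHom L) = H'.map (IsCMField.complexConj L) := by
      ext i j; simp [Matrix.map_apply, cmConjRingHom_apply]
    rw [e1]; exact hH'
  have hH := map_conjLocal_transpose_localForm L 3 H' v hH'c
  have hHd := isUnit_det_localForm L 3 H' v (Matrix.isUnit_iff_isUnit_det _ |>.1 hH'u).ne_zero
  -- (3) the four matched representatives (★ F0P3-p02)
  obtain ⟨Tl, ψ, t₁, t₂, t₃, t₄, τ₁, τ₂, τ₃, τ₄, P, P₁, dπ, g₃, g₄, hform, hψ, -, -, h₁, h₂, h₃, h₄, hP, hu', hu'1, hPP₁, hP₁,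
    hψ₁, hψ₂, hψ₃, hψ₄, hτ₁, hτ₂c, hτ₃c, hτ₄c, hdπ, hg₃, hg₄, hτ₂, hτ₃, hτ₄, n12, n34⟩ :=
    exists_four_matched_flicker_representatives L H' hH' w hw hv hH'w hH'i (γH := γH) h2e hσπ hππ hπN hx hy ha1 hd1 hP₂ had hab hbd
  -- images: `Tl tᵢ Tl⁻¹ = (ψ tᵢ) = τᵢ`
  have himg : ∀ {t : (cmDatum L 3 H').Local v} {τ : ↥(UnitaryGroup.«local» L (IsCMField.complexConj L) 3
      (Matrix.of fun i j : Fin 3 => if i.val + j.val + 1 = 3 then (1 : L) else 0) v)}, ψ t = τ → Tl * t.val * Tl⁻¹ = τ.val := by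
    intro t τ h
    rw [← hψ t, h]
  -- (4) the signs (★ FILE B)
  obtain ⟨hκ₁, hκ₂, hκ₃, hκ₄⟩ := finKappaAt_flicker_representatives_eq L v H' γH w hw hu hH hHd h2e hσπ hπN hx hy hform h₁ h₃ h₄ hP hu' hu'1 hPP₁ hP₁
    hdπ hg₃ hg₄ (by rw [himg hψ₂, himg hψ₁, hτ₂c]) (by rw [himg hψ₃, himg hψ₁, hτ₃c]) (by rw [himg hψ₄, himg hψ₁, hτ₄c])
  -- (5) the values at the four classes
  have hX₁ : classOrbitalIntegral mG f (ConjClasses.mk t₁) = X₁ := hΦ₁ Tl t₁ hform (by rw [himg hψ₁, hτ₁])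
  have hX₂ : classOrbitalIntegral mG f (ConjClasses.mk t₂) = X₂ := hΦ₂ Tl t₂ hform (by rw [himg hψ₂, hτ₂])
  have hX₃ : classOrbitalIntegral mG f (ConjClasses.mk t₃) = X₃ := hΦ₃ Tl t₃ hform (by rw [himg hψ₃, hτ₃])
  have hX₄ : classOrbitalIntegral mG f (ConjClasses.mk t₄) = X₄ := hΦ₄ Tl t₄ hform (by rw [himg hψ₄, hτ₄])
  -- (6) HEAD 1 and the exponent
  rw [finsum_delta_mul_classOrbitalIntegral_eq_of_four_classes_of_values L v H' γH w hw μ hμω hv hμ hl hr h₁ h₂ h₃ h₄ hu hH hHd hP hu' hu'1 n12 n34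
    hκ₁ hκ₂ hκ₃ hκ₄ mG f hX₁ hX₂ hX₃ hX₄, hlog]

open scoped Classical in
/-- **(F12) HEAD 3, ED. 2 — the value labels carry the LEVEL-PRESERVING CONGRUENCE `ψ`** (weaker hypotheses on the four values, so the value theorems plug ★
F0P3-p02's `natCard_fixedBy_cmLocalIntegralLevel_eq_of_congr (ψ) (hlev)` directly): `Xᵢ` is the orbital integral of `f` on the class of ANY `t ∈ G′_v` for which SOME
congruence `Tl` (`ᵗσ(Tl) Φ₃ Tl = H′_v`) with a topological-group isomorphism `ψ : G′_v ≃ U(Φ₃)(L⁺_v)`, `ψ g = Tl g Tl⁻¹`, PRESERVING THE LEVELS (`g ∈ K′ ↔ ψ g ∈ K_Φ`),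
maps `t` to Flicker's `i`-th literal; then `∑ᶠ c, Δ‴_v(γ_H, out c)·Φ(c, f) = (−q_v)^{−(N₁+N₂)}·(X₁ + X₂ − X₃ − X₄)`. (All of `Tl, ψ, hform, hψ, hlev` are conjuncts of ★
`exists_four_matched_flicker_representatives`.) [cite: Flicker1998UnitaryFL, Prop. 3 p. 78; §6 p. 95] [cite: Rogawski1990, §4.3 (4.3.1)–(4.3.2) p. 43; §4.9 Prop. 4.9.1 (b) p. 55] -/
theorem finsum_finExplicitDelta_mul_classOrbitalIntegral_eq_of_split_of_values'
    (hH' : (H'.map (IsCMField.complexConj L))ᵀ = H') (w : PlacesOver L v)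
    (hw : IsCMField.complexConj L • w.1 = w.1) (hv : Algebra.IsUnramifiedIn (𝓞 L) v.asIdeal)
    (hH'w : IsUnit (placeForm H' w.1)) (hH'i : hH'w.unit ∈ glInt 3 (w.1.adicCompletion L))
    (μ : HeckeCharacter L) (hμ : μ.IsUnramifiedAt w.1)
    [∀ γ : ((cmDatum L 3 H').Local v), MeasurableSpace (((cmDatum L 3 H').Local v) ⧸ Subgroup.centralizer ({γ} : Set ((cmDatum L 3 H').Local v)))]
    (hl : ∀ (v : HeightOneSpectrum (𝓞 ↥(maximalRealSubfield L)))
      (a : (cmDatum L 2 (Matrix.of fun i j : Fin 2 => if i.val + j.val + 1 = 2 then (1 : L) else 0)).Local v ×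
      (cmDatum L 1 (Matrix.of fun i j : Fin 1 => if i.val + j.val + 1 = 1 then (1 : L) else 0)).Local v)
      (b : (cmDatum L 3 H').Local v)
      (x : (cmDatum L 2 (Matrix.of fun i j : Fin 2 => if i.val + j.val + 1 = 2 then (1 : L) else 0)).Local v ×
      (cmDatum L 1 (Matrix.of fun i j : Fin 1 => if i.val + j.val + 1 = 1 then (1 : L) else 0)).Local v),
      finExplicitDelta L v H' (x * a * x⁻¹) μ b = finExplicitDelta L v H' a μ b)
    (hr : ∀ (v : HeightOneSpectrum (𝓞 ↥(maximalRealSubfield L)))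
      (a : (cmDatum L 2 (Matrix.of fun i j : Fin 2 => if i.val + j.val + 1 = 2 then (1 : L) else 0)).Local v ×
      (cmDatum L 1 (Matrix.of fun i j : Fin 1 => if i.val + j.val + 1 = 1 then (1 : L) else 0)).Local v)
      (b y : (cmDatum L 3 H').Local v),
      finExplicitDelta L v H' a μ (y * b * y⁻¹) = finExplicitDelta L v H' a μ b)
    (hH'u : IsUnit H')
    (hμω : ∀ x : ideleGroup ↥(maximalRealSubfield L), μ (AdeleRing.ideleBaseChange ↥(maximalRealSubfield L) L x) = quadraticHeckeCharCM L x)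
    {γH : ((cmDatum L 2 (Matrix.of fun i j : Fin 2 => if i.val + j.val + 1 = 2 then (1 : L) else 0)).Local v ×
      (cmDatum L 1 (Matrix.of fun i j : Fin 1 => if i.val + j.val + 1 = 1 then (1 : L) else 0)).Local v)}
    -- the split eigen-data of `stub_splitExponents`
    (α γ : w.1.adicCompletion L) (N₁ N₂ : ℕ)
    (hα : ((((γH.1.val : GL (Fin 2) (LocalRing L v)) : Matrix (Fin 2) (Fin 2) (LocalRing L v)).charpoly).map
        (Pi.evalRingHom (fun w' : PlacesOver L v => w'.1.adicCompletion L) w)).IsRoot α)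
    (hγ : ((((γH.1.val : GL (Fin 2) (LocalRing L v)) : Matrix (Fin 2) (Fin 2) (LocalRing L v)).charpoly).map
        (Pi.evalRingHom (fun w' : PlacesOver L v => w'.1.adicCompletion L) w)).IsRoot γ)
    (hαγ : α ≠ γ)
    (hN₁ : Valued.v (α - finGammaTwo L v γH w) = WithZero.exp (-(N₁ : ℤ)))
    (hN₂ : Valued.v (γ - finGammaTwo L v γH w) = WithZero.exp (-(N₂ : ℤ)))
    -- Flicker's scalars (★ `exists_flicker_scalars_of_nonsplit`) and an eigenframe of `g` over `E_v` (★ (E1))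
    {e π π' x y a d : LocalRing L v} (h2e : 2 * e = 1) (hσπ : conjLocal L (IsCMField.complexConj L) v π = π) (hππ : π * π' = 1)
    (hπN : ∀ z : LocalRing L v, conjLocal L (IsCMField.complexConj L) v z * z ≠ π)
    (hx : conjLocal L (IsCMField.complexConj L) v x * x = 2) (hy : conjLocal L (IsCMField.complexConj L) v y * y = -2)
    (ha1 : conjLocal L (IsCMField.complexConj L) v a * a = 1) (hd1 : conjLocal L (IsCMField.complexConj L) v d * d = 1)
    {P₂ : GL (Fin 2) (LocalRing L v)} (hP₂ : (γH.1.val.val : Matrix (Fin 2) (Fin 2) (LocalRing L v)) * P₂.val = P₂.val * diagonal ![a, d])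
    (had : a ≠ d) (hab : a ≠ finGammaTwo L v γH) (hbd : finGammaTwo L v γH ≠ d)
    -- the test function, the family, and the four VALUES labelled by Flicker's literals
    (mG : OrbitalMeasureFamily ((cmDatum L 3 H').Local v)) (f : (cmDatum L 3 H').Local v → ℂ) {X₁ X₂ X₃ X₄ : ℂ}
    (hΦ₁ : ∀ (Tl : GL (Fin 3) (LocalRing L v)) (ψ : ↥(UnitaryGroup.«local» L (IsCMField.complexConj L) 3 H' v) ≃ₜ*
        ↥(UnitaryGroup.«local» L (IsCMField.complexConj L) 3 (Matrix.of fun i j : Fin 3 => if i.val + j.val + 1 = 3 then (1 : L) else 0) v))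
      (t : (cmDatum L 3 H').Local v),
      formCongr (conjLocal L (IsCMField.complexConj L) v) Tl (Matrix.of fun i j : Fin 3 => if i.val + j.val + 1 = 3 then (1 : LocalRing L v) else 0) =
          (adelicForm L 3 H').map (adeleToLocal L v) →
      (∀ g, (ψ g).val = Tl * g.val * Tl⁻¹) →
      (∀ g, g ∈ cmLocalIntegralLevel L 3 H' v ↔
        ψ g ∈ cmLocalIntegralLevel L 3 (Matrix.of fun i j : Fin 3 => if i.val + j.val + 1 = 3 then (1 : L) else 0) v) →
      (ψ t).val.val =
          !![e * (a + d), 0, -(e * (a - d)); 0, finGammaTwo L v γH, 0; -(e * (a - d)), 0, e * (a + d)] →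
      classOrbitalIntegral mG f (ConjClasses.mk t) = X₁)
    (hΦ₂ : ∀ (Tl : GL (Fin 3) (LocalRing L v)) (ψ : ↥(UnitaryGroup.«local» L (IsCMField.complexConj L) 3 H' v) ≃ₜ*
        ↥(UnitaryGroup.«local» L (IsCMField.complexConj L) 3 (Matrix.of fun i j : Fin 3 => if i.val + j.val + 1 = 3 then (1 : L) else 0) v))
      (t : (cmDatum L 3 H').Local v),
      formCongr (conjLocal L (IsCMField.complexConj L) v) Tl (Matrix.of fun i j : Fin 3 => if i.val + j.val + 1 = 3 then (1 : LocalRing L v) else 0) =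
          (adelicForm L 3 H').map (adeleToLocal L v) →
      (∀ g, (ψ g).val = Tl * g.val * Tl⁻¹) →
      (∀ g, g ∈ cmLocalIntegralLevel L 3 H' v ↔
        ψ g ∈ cmLocalIntegralLevel L 3 (Matrix.of fun i j : Fin 3 => if i.val + j.val + 1 = 3 then (1 : L) else 0) v) →
      (ψ t).val.val =
          !![e * (a + d), 0, -(e * (a - d) * π); 0, finGammaTwo L v γH, 0; -(e * (a - d) * π'), 0, e * (a + d)] →
      classOrbitalIntegral mG f (ConjClasses.mk t) = X₂)
    (hΦ₃ : ∀ (Tl : GL (Fin 3) (LocalRing L v)) (ψ : ↥(UnitaryGroup.«local» L (IsCMField.complexConj L) 3 H' v) ≃ₜ*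
        ↥(UnitaryGroup.«local» L (IsCMField.complexConj L) 3 (Matrix.of fun i j : Fin 3 => if i.val + j.val + 1 = 3 then (1 : L) else 0) v))
      (t : (cmDatum L 3 H').Local v),
      formCongr (conjLocal L (IsCMField.complexConj L) v) Tl (Matrix.of fun i j : Fin 3 => if i.val + j.val + 1 = 3 then (1 : LocalRing L v) else 0) =
          (adelicForm L 3 H').map (adeleToLocal L v) →
      (∀ g, (ψ g).val = Tl * g.val * Tl⁻¹) →
      (∀ g, g ∈ cmLocalIntegralLevel L 3 H' v ↔
        ψ g ∈ cmLocalIntegralLevel L 3 (Matrix.of fun i j : Fin 3 => if i.val + j.val + 1 = 3 then (1 : L) else 0) v) →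
      (ψ t).val.val =
          !![e * (a + finGammaTwo L v γH), 0, -(e * (a - finGammaTwo L v γH) * π); 0, d, 0;
             -(e * (a - finGammaTwo L v γH) * π'), 0, e * (a + finGammaTwo L v γH)] →
      classOrbitalIntegral mG f (ConjClasses.mk t) = X₃)
    (hΦ₄ : ∀ (Tl : GL (Fin 3) (LocalRing L v)) (ψ : ↥(UnitaryGroup.«local» L (IsCMField.complexConj L) 3 H' v) ≃ₜ*
        ↥(UnitaryGroup.«local» L (IsCMField.complexConj L) 3 (Matrix.of fun i j : Fin 3 => if i.val + j.val + 1 = 3 then (1 : L) else 0) v))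
      (t : (cmDatum L 3 H').Local v),
      formCongr (conjLocal L (IsCMField.complexConj L) v) Tl (Matrix.of fun i j : Fin 3 => if i.val + j.val + 1 = 3 then (1 : LocalRing L v) else 0) =
          (adelicForm L 3 H').map (adeleToLocal L v) →
      (∀ g, (ψ g).val = Tl * g.val * Tl⁻¹) →
      (∀ g, g ∈ cmLocalIntegralLevel L 3 H' v ↔
        ψ g ∈ cmLocalIntegralLevel L 3 (Matrix.of fun i j : Fin 3 => if i.val + j.val + 1 = 3 then (1 : L) else 0) v) →
      (ψ t).val.val =
          !![e * (finGammaTwo L v γH + d), 0, -(e * (finGammaTwo L v γH - d) * π); 0, a, 0;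
             -(e * (finGammaTwo L v γH - d) * π'), 0, e * (finGammaTwo L v γH + d)] →
      classOrbitalIntegral mG f (ConjClasses.mk t) = X₄) :
    ∑ᶠ c : ConjClasses ((cmDatum L 3 H').Local v),
        (finExplicitCollection L H' μ hl hr v).Δ γH (Quotient.out c) * classOrbitalIntegral mG f c =
      (-(Ideal.absNorm v.asIdeal : ℂ)) ^ (-((N₁ : ℤ) + N₂)) * (X₁ + X₂ - X₃ - X₄) := by
  have hvs : Subsingleton (PlacesOver L v) :=
    PlacesOver.subsingleton_of_smul_eq (IsCMField.complexConj L) (IsCMField.complexConj_ne_one L) w hw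
  -- (1) `χ_g(u)` is a unit and the exponent is `−(N₁+N₂)` (★ A-p13)
  have hα' : ((finCharpolyTwo L v γH).map (Pi.evalRingHom (fun w' : PlacesOver L v => w'.1.adicCompletion L) w)).IsRoot α := hα
  have hγ' : ((finCharpolyTwo L v γH).map (Pi.evalRingHom (fun w' : PlacesOver L v => w'.1.adicCompletion L) w)).IsRoot γ := hγ
  have hαb : α ≠ finGammaTwo L v γH w := fun h0 => by
    rw [h0, sub_self, map_zero] at hN₁; exact WithZero.zero_ne_coe hN₁
  have hγb : γ ≠ finGammaTwo L v γH w := fun h0 => by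
    rw [h0, sub_self, map_zero] at hN₂; exact WithZero.zero_ne_coe hN₂
  have hu : IsUnit ((finCharpolyTwo L v γH).eval (finGammaTwo L v γH)) := isUnit_eval_finCharpolyTwo_of_isRoot L v w γH hvs hα' hγ' hαγ hαb hγb
  have hlog := log_valued_eval_finCharpolyTwo_apply_eq_neg_add L v w γH hα' hγ' hαγ hN₁ hN₂
  -- (2) the local hermitian data of `H′`
  have hH'c : (H'.map (cmConjRingHom L))ᵀ = H' := by
    have e1 : H'.map (cmConjRingHom L) = H'.map (IsCMField.complexConj L) := by
      ext i j; simp [Matrix.map_apply, cmConjRingHom_apply]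
    rw [e1]; exact hH'
  have hH := map_conjLocal_transpose_localForm L 3 H' v hH'c
  have hHd := isUnit_det_localForm L 3 H' v (Matrix.isUnit_iff_isUnit_det _ |>.1 hH'u).ne_zero
  -- (3) the four matched representatives (★ F0P3-p02)
  obtain ⟨Tl, ψ, t₁, t₂, t₃, t₄, τ₁, τ₂, τ₃, τ₄, P, P₁, dπ, g₃, g₄, hform, hψ, -, hlev, h₁, h₂, h₃, h₄, hP, hu', hu'1, hPP₁, hP₁,
    hψ₁, hψ₂, hψ₃, hψ₄, hτ₁, hτ₂c, hτ₃c, hτ₄c, hdπ, hg₃, hg₄, hτ₂, hτ₃, hτ₄, n12, n34⟩ :=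
    exists_four_matched_flicker_representatives L H' hH' w hw hv hH'w hH'i (γH := γH) h2e hσπ hππ hπN hx hy ha1 hd1 hP₂ had hab hbd
  -- images: `Tl tᵢ Tl⁻¹ = (ψ tᵢ) = τᵢ`
  have himg : ∀ {t : (cmDatum L 3 H').Local v} {τ : ↥(UnitaryGroup.«local» L (IsCMField.complexConj L) 3
      (Matrix.of fun i j : Fin 3 => if i.val + j.val + 1 = 3 then (1 : L) else 0) v)}, ψ t = τ → Tl * t.val * Tl⁻¹ = τ.val := by
    intro t τ h
    rw [← hψ t, h]
  -- (4) the signs (★ FILE B)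
  obtain ⟨hκ₁, hκ₂, hκ₃, hκ₄⟩ := finKappaAt_flicker_representatives_eq L v H' γH w hw hu hH hHd h2e hσπ hπN hx hy hform h₁ h₃ h₄ hP hu' hu'1 hPP₁ hP₁
    hdπ hg₃ hg₄ (by rw [himg hψ₂, himg hψ₁, hτ₂c]) (by rw [himg hψ₃, himg hψ₁, hτ₃c]) (by rw [himg hψ₄, himg hψ₁, hτ₄c])
  -- (5) the values at the four classes
  have hX₁ : classOrbitalIntegral mG f (ConjClasses.mk t₁) = X₁ := hΦ₁ Tl ψ t₁ hform hψ hlev (by rw [hψ₁, hτ₁])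
  have hX₂ : classOrbitalIntegral mG f (ConjClasses.mk t₂) = X₂ := hΦ₂ Tl ψ t₂ hform hψ hlev (by rw [hψ₂, hτ₂])
  have hX₃ : classOrbitalIntegral mG f (ConjClasses.mk t₃) = X₃ := hΦ₃ Tl ψ t₃ hform hψ hlev (by rw [hψ₃, hτ₃])
  have hX₄ : classOrbitalIntegral mG f (ConjClasses.mk t₄) = X₄ := hΦ₄ Tl ψ t₄ hform hψ hlev (by rw [hψ₄, hτ₄])
  -- (6) HEAD 1 and the exponent
  rw [finsum_delta_mul_classOrbitalIntegral_eq_of_four_classes_of_values L v H' γH w hw μ hμω hv hμ hl hr h₁ h₂ h₃ h₄ hu hH hHd hP hu' hu'1 n12 n34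
    hκ₁ hκ₂ hκ₃ hκ₄ mG f hX₁ hX₂ hX₃ hX₄, hlog]

end Adapter

end Literature.NumberTheory.Rogawski1990

end
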